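import Summits.Parity.GeneralizedHardyLittlewood.Theorems.BeyondDiagonalBeatsQuarter.OffDiagDualSwitchForm
import Summits.Parity.GeneralizedHardyLittlewood.Theorems.BeyondDiagonalBeatsQuarter.OffDiagDualCountSwap
import HarnessLib

/-!
# Route `PrimeLevelFamEdge`, crux K_B (stmt-Parity-20343), line `diagonal_kernel_split` rev 4, plan Ω (KEYS-NEXT S5) —
# **the dual series of a box in `(h₂, s)`-form when the SECOND frequency parameter `β` is a unit**

`OffDiagDualSwitchForm.tsum_dual_eq_tsum_switch` (p641894) needs `α = l/d₁` to be a unit mod `C = q(r+1)`; by the symmetry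
`OffDiag.dualCount_swap` (p642224) the same evaluation holds with the roles of `(α,h₁)` and `(β,h₂)` exchanged whenever
`β = m/d₂` is a unit — so every layer with `(l/d₁, r+1) = 1` OR `(m/d₂, r+1) = 1` has an exact divisor-switched form, and only
the doubly non-coprime stratum is left to the gcd-bounds (`OffDiagDualCountStrata`):

* `tsum_prod_swap` — `Σ'_{(h₁,h₂)} f(h₁,h₂) = Σ'_{(h₂,h₁)} f(h₁,h₂)` (re-indexing by `Prod.swap`);
* **`tsum_dual_eq_tsum_switch_right`** — for `C ≥ 2`, `b` a unit mod `C`, summable dual family: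
  `Σ_{h∈ℤ²} Φ̂(h₁/C,h₂/C)·N_C(a,b;h₁,h₂) = Σ_{h₂ unit} Σ_{s: h₂∣ab+Cs} Φ̂(s/h₂ + ab/(h₂C), h₂/C)`.

Bookkeeping over landed theorems; theorems only; standard axioms. Helper; closes nothing.
«The programme SEARCHES and TYPES; no claim about Landau–Siegel zeros, Theorems 1–2 of arXiv:2211.02515 or
a repaired Margin232 until a kernel theorem says so.»
-/

noncomputable section

open Finset
open scoped Real FourierTransform

namespace Summit.Parity.GeneralizedHardyLittlewood.Theorems.BeyondDiagonalBeatsQuarter.OffDiag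

open Literature.NumberTheory.Sieve.FriedlanderIwaniecPrimes (fourier2)

variable {C : ℕ} [NeZero C]

omit [NeZero C] in
/-- Re-indexing a `ℤ²`-series by the swap of coordinates. [folklore] -/
theorem tsum_prod_swap (f : ℤ × ℤ → ℂ) : ∑' h : ℤ × ℤ, f h = ∑' h : ℤ × ℤ, f h.swap :=
  ((Equiv.prodComm ℤ ℤ).tsum_eq (fun h ↦ f h.swap)).symm.trans (by simp [Equiv.prodComm_apply]) |>.symm

/-- **The dual series of a box in `(h₂, s)`-form (β-unit stratum).** For `C ≥ 2`, naturals `a, b` with `b` a unit mod `C`,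
and any `Φ` whose dual family is summable:
`Σ_{h∈ℤ²} Φ̂(h₁/C,h₂/C)·N_C(a,b;h₁,h₂) = Σ_{h₂∈ℤ} 𝟙[h₂ unit]·Σ_{s∈ℤ} 𝟙[h₂ ∣ ab + Cs]·Φ̂(s/h₂ + ab/(h₂C), h₂/C)`.
[cite: KowalskiMichelVanderKam2000, Lemma 3.3 p. 9 — derivation] -/
theorem tsum_dual_eq_tsum_switch_right (hC : 2 ≤ C) (a : ℕ) {b : ℕ} (hb : IsUnit ((b : ℕ) : ZMod C))
    (Φ : ℝ → ℝ → ℂ)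
    (hS : Summable fun h : ℤ × ℤ ↦ fourier2 Φ (h.1 / C) (h.2 / C) *
      (dualCount C (a : ZMod C) (b : ZMod C) (h.1 : ZMod C) (h.2 : ZMod C) : ℂ)) :
    ∑' h : ℤ × ℤ, fourier2 Φ (h.1 / C) (h.2 / C) *
        (dualCount C (a : ZMod C) (b : ZMod C) (h.1 : ZMod C) (h.2 : ZMod C) : ℂ) =
      ∑' h₂ : ℤ, (if IsUnit ((h₂ : ℤ) : ZMod C) then
        ∑' s : ℤ, (if h₂ ∣ (b : ℤ) * a + (C : ℤ) * s then
          fourier2 Φ ((s : ℝ) / h₂ + ((b : ℤ) * a : ℝ) / ((h₂ : ℝ) * C)) (h₂ / C) else 0) else 0) := by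
  -- swap coordinates and the roles of (a, b), then apply the left-unit form to Ψ(t₂,t₁)-frequencies
  have hswapN : ∀ h : ℤ × ℤ, (dualCount C (a : ZMod C) (b : ZMod C) (h.1 : ZMod C) (h.2 : ZMod C) : ℂ) =
      (dualCount C (b : ZMod C) (a : ZMod C) (h.2 : ZMod C) (h.1 : ZMod C) : ℂ) := fun h ↦ by
    rw [dualCount_swap]
  simp_rw [hswapN]
  rw [tsum_prod_swap]
  simp only [Prod.fst_swap, Prod.snd_swap]
  -- now the family is `fourier2 Φ (h.2/C) (h.1/C) · N_C(b,a;h.1,h.2)`: the left-unit form for the function with swapped slots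
  have hS' : Summable fun h : ℤ × ℤ ↦ fourier2 Φ (h.2 / C) (h.1 / C) *
      (dualCount C (b : ZMod C) (a : ZMod C) (h.1 : ZMod C) (h.2 : ZMod C) : ℂ) := by
    have := hS.prod_symm
    refine this.congr fun h ↦ ?_
    simp only [Prod.fst_swap, Prod.snd_swap]
    rw [dualCount_swap]
  -- run the proof of the left form with the frequency slots exchanged (same steps as `tsum_dual_eq_tsum_switch`)
  classical
  rw [hS'.tsum_prod]
  refine tsum_congr fun h₂ ↦ ?_
  have hN : ∀ h₁ : ℤ, (dualCount C (b : ZMod C) (a : ZMod C) (h₂ : ZMod C) (h₁ : ZMod C) : ℂ) =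
      if IsUnit ((h₂ : ℤ) : ZMod C) ∧ ((h₂ : ℤ) : ZMod C) * ((h₁ : ℤ) : ZMod C) = (b : ZMod C) * (a : ZMod C)
      then 1 else 0 := by
    intro h₁
    rw [OffDiagDual.dualCount_eq_ite_of_isUnit hb]
    split_ifs <;> simp
  simp_rw [hN]
  by_cases hu : IsUnit ((h₂ : ℤ) : ZMod C)
  · rw [if_pos hu]
    have hh₂ : h₂ ≠ 0 := intCast_ne_zero_of_isUnit hC hu
    have hstep : ∀ h₁ : ℤ, fourier2 Φ (h₁ / C) (h₂ / C) *
        (if IsUnit ((h₂ : ℤ) : ZMod C) ∧ ((h₂ : ℤ) : ZMod C) * ((h₁ : ℤ) : ZMod C) = (b : ZMod C) * (a : ZMod C)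
          then (1 : ℂ) else 0) =
        (if ((h₂ : ℤ) : ZMod C) * ((h₁ : ℤ) : ZMod C) = ((b : ℤ) : ZMod C) * ((a : ℤ) : ZMod C)
          then fourier2 Φ (((h₁ : ℤ) : ℝ) / C) (h₂ / C) else 0) := by
      intro h₁
      by_cases hc : ((h₂ : ℤ) : ZMod C) * ((h₁ : ℤ) : ZMod C) = (b : ZMod C) * (a : ZMod C)
      · rw [if_pos ⟨hu, hc⟩, mul_one, if_pos (by push_cast; exact hc)]
      · rw [if_neg (fun h ↦ hc h.2), mul_zero, if_neg (by push_cast; exact hc)]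
    simp_rw [hstep]
    rw [tsum_hyperbola_eq_tsum_switch (M := ℂ) (le_trans (by norm_num) hC) hh₂
      (F := fun h₁ ↦ fourier2 Φ (((h₁ : ℤ) : ℝ) / C) (h₂ / C))]
    refine tsum_congr fun s ↦ ?_
    by_cases hd : h₂ ∣ (b : ℤ) * a + (C : ℤ) * s
    · rw [if_pos hd, if_pos hd, switch_frequency_eq hh₂ hd]
      push_cast
      ring_nf
    · rw [if_neg hd, if_neg hd]
  · rw [if_neg hu]
    simp [hu]

end Summit.Parity.GeneralizedHardyLittlewood.Theorems.BeyondDiagonalBeatsQuarter.OffDiag
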